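/-
Copyright (c) 2026 the pub-hodgecm-mathlib formalisation cell (harness21).  Prover seat hodgecm-mathlib-B-p14 (g35): road «S3-tree» (LEAD F0P3a-plan (g11); architect A-p16 (g28∕g29);
acting architect F0P3-p01 (g16)), brick T1d′ «discharging `htr₂`», FILE 1 = THE GRAM MATRIX OF A TYPE-TWO VERTEX IN AN ADAPTED BASIS; 2026-09-01.
-/
import Literature.NumberTheory.Automorphic.UnitaryLatticeTreeTypeTwoChild   -- ★ T1d-C3a (B-p14 (g35)); brings the whole T1 chain, ★ `HermitianLatticesLocal` (`UnramifiedLocalConjDatum`), Mathlib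
import HarnessLib

/-!
# The lattice graph of a hermitian space — XI: the Gram matrix of a TYPE-TWO vertex in an adapted basis (towards the type-two transitivity `htr₂`;
# Jacobowitz 1962 §4, §7; O'Meara §82F)

Topic `NumberTheory/Automorphic`; namespace `Literature.NumberTheory.Automorphic.UnitaryLatticeTree`.  THEOREMS ONLY (no definition, no instance, no notation, no named fact,
no `sorry`); kernel lane.  Cell `pub/hodgecm-mathlib` (D-0151), crux H413 = `stmt-HodgeConjecture-24833`; road «S3-tree», brick **T1d′**: the discharge of the one binder `htr₂`
(«`U(J₀)` acts transitively on the type-two vertices») of ★ `isTree_latticeGraph_three`, FILE 1 of 2.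
HONEST LABEL: HC_CM is proved only modulo the 2 remaining named inputs (hLiu418 24832, h413 24833) until rung 0 closes; nothing printed is asserted here (elementary lattice algebra
over a valuation ring with involution); S3 stays a print row until the road's END lands.

THE MATHEMATICS.  `N = latt g` a type-two vertex for `J₀` on `K³` (Gram `G = ᵗσ(g)J₀g` integral, `ϖG⁻¹` integral, `|det G| = |ϖ|²`), `hd : UnramifiedLocalConjDatum σ ϖ`.
(§29) the three vertex conditions hold in EVERY basis of `N` (`vertexTriple_of_latt_eq`); (§30) some Gram entry is a unit (`|det G| = |ϖ|² > |ϖ|³`), hence — by a transvection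
with the trace element `t + σt = 1` if only an off-diagonal entry is — some basis vector `x` has `|h(x,x)| = 1` (`exists_basis_v_B₀_eq_one`); (§31) two more transvections make the other
two basis vectors orthogonal to `x` (`exists_orthogonal_basis`); (§32) in such a basis `G = [ε] ⊕ G₁` and the type-two conditions force `G₁ ∈ ϖ·M₂(𝒪)` with `|det G₁| = |ϖ|²`
(`typeTwo_block`): the Jordan splitting `N = 𝒪x ⊥ N′`, `N′` `ϖ`-modular of rank `2`.  FILE 2 (`UnitaryLatticeTreeTypeTwoTransitive`) finds an exactly hyperbolic basis of `N′`
(isotropy of `J₀` + ★ `UnramifiedLocalConjDatum.exists_isotropic_coeff`) and normalises `ε` by the determinant class, giving `N = u·N₁`, `u ∈ U(J₀)`.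

* §29 `isIntMatrix_mul`, `isIntMatrix_transpose_map`, `v_det_eq_one_of_isIntMatrix_inv`, `latt_mul_eq_of_isIntMatrix`, **`vertexTriple_of_latt_eq`**, `formCongr_apply_eq_B₀`.
* §30 `exists_v_apply_eq_one_of_v_det`, `transvection_mulVec_single`, `isIntMatrix_transvection`, `isIntMatrix_permMatrix`, **`exists_basis_v_B₀_eq_one`**.
* §31 **`exists_orthogonal_basis`**.  §32 **`typeTwo_block`**.

## References
* [Jacobowitz1962] R. Jacobowitz, *Hermitian forms over local fields*, Amer. J. Math. 84 (1962), §4 (Jordan splittings), §7 (unramified dyadic).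
* [Omeara1963] O. T. O'Meara, *Introduction to Quadratic Forms* (1963), §82F, §91C (Jordan splittings).
* [BruhatTits1972] F. Bruhat, J. Tits, *Groupes réductifs sur un corps local I*, Publ. Math. IHÉS 41 (1972), §10.
-/

set_option autoImplicit false

noncomputable section

open scoped Valued WithZero Matrix MatrixGroups

namespace Literature.NumberTheory.Automorphic.UnitaryLatticeTree

open Literature.NumberTheory.Automorphic Literature.NumberTheory.Automorphic.HermitianLattice
open Literature.NumberTheory.Automorphic.CartanUnique

variable {K : Type*} [Field K] [Valued K ℤᵐ⁰] {σ : K →+* K} {ϖ : K} {N : ℕ}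

/-! ## §29 Integral matrices; the vertex conditions in an arbitrary basis -/

/-- A product of integral matrices is integral. [cite: Omeara1963, §82F] -/
theorem isIntMatrix_mul {A B : Matrix (Fin N) (Fin N) K} (hA : IsIntMatrix A) (hB : IsIntMatrix B) : IsIntMatrix (A * B) := by
  intro i j
  rw [Matrix.mul_apply]
  refine Valuation.map_sum_le _ fun k _ => ?_
  rw [map_mul]; exact mul_le_one' (hA i k) (hB k j)

/-- `ᵗσ(A)` is integral when `A` is (`σ` valuation-preserving). [cite: Omeara1963, §82F] -/
theorem isIntMatrix_transpose_map (hvσ : ∀ a, Valued.v (σ a) = Valued.v a) {A : Matrix (Fin N) (Fin N) K} (hA : IsIntMatrix A) :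
    IsIntMatrix (A.map σ)ᵀ := fun i j => by
  rw [Matrix.transpose_apply, Matrix.map_apply, hvσ]; exact hA j i

/-- An invertible matrix which is integral together with its inverse has unit determinant. [cite: Omeara1963, §82F] -/
theorem v_det_eq_one_of_isIntMatrix_inv {E : GL (Fin N) K} (hE : IsIntMatrix (E : Matrix (Fin N) (Fin N) K))
    (hE' : IsIntMatrix ((E⁻¹ : GL (Fin N) K) : Matrix (Fin N) (Fin N) K)) : Valued.v (E : Matrix (Fin N) (Fin N) K).det = 1 := by
  have h2 := v_det_le_one_of_forall_v_le_one hE'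
  have hprod : Valued.v (E : Matrix (Fin N) (Fin N) K).det * Valued.v ((E⁻¹ : GL (Fin N) K) : Matrix (Fin N) (Fin N) K).det = 1 := by
    rw [← map_mul, ← Matrix.det_mul, ← Units.val_mul, mul_inv_cancel, Units.val_one, Matrix.det_one, map_one]
  refine le_antisymm (v_det_le_one_of_forall_v_le_one hE) ?_
  calc (1 : ℤᵐ⁰) = _ := hprod.symm
    _ ≤ Valued.v (E : Matrix (Fin N) (Fin N) K).det * 1 := mul_le_mul_right h2 _
    _ = _ := mul_one _

/-- **Right multiplication by `GL_N(𝒪)` does not change the lattice**: `latt (g·E) = latt g` for `E`, `E⁻¹` integral. [cite: Serre1980Trees, II.1.1] -/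
theorem latt_mul_eq_of_isIntMatrix (g E : GL (Fin N) K) (hE : IsIntMatrix (E : Matrix (Fin N) (Fin N) K)) (hE' : IsIntMatrix ((E⁻¹ : GL (Fin N) K) : Matrix (Fin N) (Fin N) K)) :
    latt ((g * E : GL (Fin N) K) : Matrix (Fin N) (Fin N) K) = latt (g : Matrix (Fin N) (Fin N) K) := by
  refine le_antisymm ?_ ?_
  · rw [Units.val_mul]; exact (latt_mul_le_latt_iff (Matrix.isUnits_det_units g) _).2 hE
  · have h := (latt_mul_le_latt_iff (Matrix.isUnits_det_units (g * E)) ((E⁻¹ : GL (Fin N) K) : Matrix (Fin N) (Fin N) K)).2 hE'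
    rwa [← Units.val_mul, mul_assoc, mul_inv_cancel, mul_one] at h

/-- **THE VERTEX CONDITIONS HOLD IN EVERY BASIS**: if `latt g′` is a vertex lattice of type `d`, then the Gram matrix `G′ = ᵗσ(g′)Hg′` of THIS basis is integral, `ϖG′⁻¹` is integral
and `|det G′| = |ϖ|^d` (the two bases differ by `E ∈ GL_N(𝒪)`, and `G′ = ᵗσ(E) G E`). [cite: Jacobowitz1962, §4] [cite: Omeara1963, §82F] -/
theorem vertexTriple_of_latt_eq (hvσ : ∀ a, Valued.v (σ a) = Valued.v a) {H : Matrix (Fin N) (Fin N) K} {d : ℕ} {g' : GL (Fin N) K}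
    (hM : IsVertexLattice σ ϖ H d (latt (g' : Matrix (Fin N) (Fin N) K))) :
    IsIntMatrix (formCongr σ g' H) ∧ IsIntMatrix (ϖ • (formCongr σ g' H)⁻¹) ∧ Valued.v (formCongr σ g' H).det = Valued.v ϖ ^ d := by
  obtain ⟨g, hgg', hint, hinv, hdet⟩ := hM
  -- `E := g⁻¹ g′ ∈ GL_N(𝒪)`
  have hE : IsIntMatrix ((g⁻¹ * g' : GL (Fin N) K) : Matrix (Fin N) (Fin N) K) := by
    rw [Units.val_mul, Matrix.coe_units_inv]; exact (latt_le_latt_iff (Matrix.isUnits_det_units g) _).1 hgg'.le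
  have hE' : IsIntMatrix (((g⁻¹ * g')⁻¹ : GL (Fin N) K) : Matrix (Fin N) (Fin N) K) := by
    rw [mul_inv_rev, inv_inv, Units.val_mul, Matrix.coe_units_inv]; exact (latt_le_latt_iff (Matrix.isUnits_det_units g') _).1 hgg'.ge
  have hdetE := v_det_eq_one_of_isIntMatrix_inv hE hE'
  set E : GL (Fin N) K := g⁻¹ * g' with hEdef
  have hg' : g' = g * E := by rw [hEdef, ← mul_assoc, mul_inv_cancel, one_mul]
  have hGG : formCongr σ g' H = ((E : Matrix (Fin N) (Fin N) K).map σ)ᵀ * formCongr σ g H * (E : Matrix (Fin N) (Fin N) K) := by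
    simp only [formCongr, hg', Units.val_mul, Matrix.map_mul, Matrix.transpose_mul, Matrix.mul_assoc]
  refine ⟨?_, ?_, ?_⟩
  · rw [hGG]; exact isIntMatrix_mul (isIntMatrix_mul (isIntMatrix_transpose_map hvσ hE) hint) hE
  · have hEu : IsUnit (E : Matrix (Fin N) (Fin N) K).det := Matrix.isUnits_det_units E
    rw [hGG, Matrix.mul_inv_rev, Matrix.mul_inv_rev, ← Matrix.mul_assoc,
      show ϖ • ((E : Matrix (Fin N) (Fin N) K)⁻¹ * (formCongr σ g H)⁻¹ * (((E : Matrix (Fin N) (Fin N) K).map σ)ᵀ)⁻¹) =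
        (E : Matrix (Fin N) (Fin N) K)⁻¹ * (ϖ • (formCongr σ g H)⁻¹) * (((E : Matrix (Fin N) (Fin N) K).map σ)ᵀ)⁻¹ by rw [Matrix.mul_smul, Matrix.smul_mul],
      ← Matrix.transpose_nonsing_inv, ← map_nonsing_inv σ hEu, ← Matrix.coe_units_inv]
    exact isIntMatrix_mul (isIntMatrix_mul hE' hinv) (isIntMatrix_transpose_map hvσ hE')
  · rw [hGG, Matrix.det_mul, Matrix.det_mul, Matrix.det_transpose, map_mul, map_mul, hdet, hdetE, mul_one,
      show ((E : Matrix (Fin N) (Fin N) K).map σ).det = σ (E : Matrix (Fin N) (Fin N) K).det by rw [RingHom.map_det, RingHom.mapMatrix_apply], hvσ, hdetE, one_mul]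

omit [Valued K ℤᵐ⁰] in
/-- **Gram entries are pairings of basis vectors**: `(ᵗσ(g)J₀g)ᵢⱼ = B₀ (g eᵢ) (g eⱼ)`. [cite: Jacobowitz1962, §4] -/
theorem formCongr_apply_eq_B₀ (g : GL (Fin N) K) (i j : Fin N) :
    formCongr σ g ((StdForm.antidiagonal N).over K) i j =
      B₀ σ N ((g : Matrix (Fin N) (Fin N) K).mulVec (Pi.single i 1)) ((g : Matrix (Fin N) (Fin N) K).mulVec (Pi.single j 1)) := by
  rw [← pairing_antidiagonal, pairing_mulVec_mulVec, pairing_single_single]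

/-! ## §30 A unit Gram entry; a basis vector of unit length -/

/-- **A type-two Gram matrix has a unit entry**: if `G ∈ M₃(𝒪)` and `|det G| = |ϖ|²` then `|Gᵢⱼ| = 1` for some `i, j` (otherwise every entry lies in `ϖ𝒪` and `|det G| ≤ |ϖ|³`).
[cite: Jacobowitz1962, §4] -/
theorem exists_v_apply_eq_one_of_v_det (hϖ : Valued.v ϖ = WithZero.exp (-1 : ℤ)) {G : Matrix (Fin 3) (Fin 3) K} (hint : IsIntMatrix G)
    (hdet : Valued.v G.det = Valued.v ϖ ^ 2) : ∃ i j, Valued.v (G i j) = 1 := by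
  by_contra h
  push Not at h
  have hle : ∀ i j, Valued.v (G i j) ≤ Valued.v ϖ := fun i j => by
    rw [hϖ]; exact (v_lt_one_iff _).1 (lt_of_le_of_ne (hint i j) (h i j))
  have h3 : ∀ a b c d e f : Fin 3, Valued.v (G a b * G c d * G e f) ≤ Valued.v ϖ ^ 3 := fun a b c d e f => by
    rw [map_mul, map_mul, pow_succ, pow_two]
    exact mul_le_mul' (mul_le_mul' (hle _ _) (hle _ _)) (hle _ _)
  have hdet' : Valued.v G.det ≤ Valued.v ϖ ^ 3 := by
    rw [Matrix.det_fin_three]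
    refine Valuation.map_sub_le _ (Valuation.map_add_le _ (Valuation.map_add_le _ (Valuation.map_sub_le _ (Valuation.map_sub_le _ (h3 ..) (h3 ..)) (h3 ..))
      (h3 ..)) (h3 ..)) (h3 ..)
  rw [hdet, hϖ, ← WithZero.exp_nsmul, ← WithZero.exp_nsmul, WithZero.exp_le_exp] at hdet'
  simp at hdet'

omit [Valued K ℤᵐ⁰] in
/-- The columns of a transvection: `(1 + c·E_{ji}) e_k = e_k + [k = i]·c·e_j`. [cite: Omeara1963, §82F] -/
theorem transvection_mulVec_single (j i k : Fin N) (c : K) :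
    (Matrix.transvection j i c).mulVec (Pi.single k 1) = Pi.single k 1 + (if k = i then c else 0) • Pi.single j 1 := by
  rw [Matrix.transvection, Matrix.add_mulVec, Matrix.one_mulVec, Matrix.single_mulVec_eq, Pi.single_apply]
  by_cases hk : k = i
  · subst hk; simp
  · simp [hk, Ne.symm hk]

/-- A transvection with integral coefficient is an integral matrix. [cite: Omeara1963, §82F] -/
theorem isIntMatrix_transvection {j i : Fin N} {c : K} (hc : Valued.v c ≤ 1) : IsIntMatrix (Matrix.transvection j i c) := by
  intro a b
  rw [Matrix.transvection, Matrix.add_apply, Matrix.one_apply, Matrix.single_apply]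
  refine Valuation.map_add_le _ ?_ ?_
  · split_ifs
    · rw [map_one]
    · rw [map_zero]; exact zero_le
  · split_ifs
    · exact hc
    · rw [map_zero]; exact zero_le

/-- A permutation matrix is an integral matrix. [cite: Omeara1963, §82F] -/
theorem isIntMatrix_permMatrix (s : Equiv.Perm (Fin N)) : IsIntMatrix (s.permMatrix K) := by
  intro a b
  rw [Equiv.Perm.permMatrix, PEquiv.toMatrix_apply]
  split_ifs
  · rw [map_one]
  · rw [map_zero]; exact zero_le

omit [Valued K ℤᵐ⁰] in
/-- The columns of a permutation matrix of a transposition: `P_{(a b)} e_k = e_{(a b) k}`. [cite: Omeara1963, §82F] -/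
theorem permMatrix_swap_mulVec_single (a b k : Fin N) : ((Equiv.swap a b).permMatrix K).mulVec (Pi.single k 1) = Pi.single (Equiv.swap a b k) 1 := by
  rw [Matrix.permMatrix_mulVec]
  funext j
  simp only [Function.comp_apply, Pi.single_apply, Equiv.swap_apply_eq_iff]

/-- **A basis of a type-two vertex whose first vector has unit length.**  For a type-two vertex lattice `M` of `(K³, J₀)` (unramified datum) there is a basis `g` of `M` with
`|h(g e₀, g e₀)| = 1`: a unit Gram entry exists (`exists_v_apply_eq_one_of_v_det`); if it is diagonal, permute; if only `h(gᵢ, gⱼ)`, `i ≠ j`, is a unit, the vector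
`gᵢ + (t ∕ h(gᵢ,gⱼ))·gⱼ` (`t + σt = 1`) has length `≡ 1 (mod 𝔪)`. [cite: Jacobowitz1962, §4, §7] [cite: Omeara1963, §82F] -/
theorem exists_basis_v_B₀_eq_one (hd : UnramifiedLocalConjDatum σ ϖ) {M : Submodule 𝒪[K] (Fin 3 → K)} (hM : IsVertexLattice σ ϖ ((StdForm.antidiagonal 3).over K) 2 M) :
    ∃ g : GL (Fin 3) K, M = latt (g : Matrix (Fin 3) (Fin 3) K) ∧
      Valued.v (B₀ σ 3 ((g : Matrix (Fin 3) (Fin 3) K).mulVec (Pi.single 0 1)) ((g : Matrix (Fin 3) (Fin 3) K).mulVec (Pi.single 0 1))) = 1 := by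
  obtain ⟨g, rfl, hint, -, hdet⟩ := id hM
  -- a swap moving index `k` to `0`
  have hswap : ∀ k : Fin 3, ∃ P : GL (Fin 3) K, IsIntMatrix (P : Matrix (Fin 3) (Fin 3) K) ∧ IsIntMatrix ((P⁻¹ : GL (Fin 3) K) : Matrix (Fin 3) (Fin 3) K) ∧
      (P : Matrix (Fin 3) (Fin 3) K).mulVec (Pi.single 0 1) = Pi.single k 1 := by
    intro k
    have hPP : (Equiv.swap (0 : Fin 3) k).permMatrix K * (Equiv.swap (0 : Fin 3) k).permMatrix K = 1 := by
      rw [← Matrix.permMatrix_mul, Equiv.swap_mul_self, Matrix.permMatrix_one]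
    refine ⟨⟨_, _, hPP, hPP⟩, isIntMatrix_permMatrix _, isIntMatrix_permMatrix _, ?_⟩
    change ((Equiv.swap (0 : Fin 3) k).permMatrix K).mulVec (Pi.single 0 1) = Pi.single k 1
    rw [permMatrix_swap_mulVec_single, Equiv.swap_apply_left]
  have hG : ∀ a b, formCongr σ g ((StdForm.antidiagonal 3).over K) a b =
      B₀ σ 3 ((g : Matrix (Fin 3) (Fin 3) K).mulVec (Pi.single a 1)) ((g : Matrix (Fin 3) (Fin 3) K).mulVec (Pi.single b 1)) := formCongr_apply_eq_B₀ g
  by_cases hdiag : ∃ k, Valued.v (formCongr σ g ((StdForm.antidiagonal 3).over K) k k) = 1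
  · obtain ⟨k, hk⟩ := hdiag
    obtain ⟨P, hP, hP', hPk⟩ := hswap k
    refine ⟨g * P, (latt_mul_eq_of_isIntMatrix g P hP hP').symm, ?_⟩
    rw [Units.val_mul, ← Matrix.mulVec_mulVec, hPk, ← hG]; exact hk
  · push Not at hdiag
    obtain ⟨i, j, hij⟩ := exists_v_apply_eq_one_of_v_det hd.vϖ hint hdet
    have hne : j ≠ i := fun h => hdiag i (by rw [← hij, h])
    obtain ⟨t, ht1, htt⟩ := hd.trace
    set β : K := formCongr σ g ((StdForm.antidiagonal 3).over K) i j with hβ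
    have hβ0 : β ≠ 0 := fun h => by rw [h, map_zero] at hij; exact zero_ne_one hij
    set c : K := t / β with hc
    have hvc : Valued.v c ≤ 1 := by rw [hc, map_div₀, hij, div_one]; exact ht1
    -- the transvection `E`: column `i` ↦ column `i` + `c`·column `j`
    have hdetT : (Matrix.transvection j i c : Matrix (Fin 3) (Fin 3) K).det ≠ 0 := by rw [Matrix.det_transvection_of_ne j i hne c]; exact one_ne_zero
    set E : GL (Fin 3) K := Matrix.GeneralLinearGroup.mkOfDetNeZero _ hdetT with hE
    have hEval : (E : Matrix (Fin 3) (Fin 3) K) = Matrix.transvection j i c := rfl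
    have hEinv : ((E⁻¹ : GL (Fin 3) K) : Matrix (Fin 3) (Fin 3) K) = Matrix.transvection j i (-c) := by
      rw [Matrix.coe_units_inv, hEval]
      exact Matrix.inv_eq_left_inv (by rw [Matrix.transvection_mul_transvection_same j i hne, neg_add_cancel, Matrix.transvection_zero])
    have hEint : IsIntMatrix (E : Matrix (Fin 3) (Fin 3) K) := by rw [hEval]; exact isIntMatrix_transvection hvc
    have hEint' : IsIntMatrix ((E⁻¹ : GL (Fin 3) K) : Matrix (Fin 3) (Fin 3) K) := by rw [hEinv]; exact isIntMatrix_transvection (by rw [Valuation.map_neg]; exact hvc)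
    -- the new `i`-th basis vector `x = gᵢ + c·gⱼ` has unit length
    set x : Fin 3 → K := (g : Matrix (Fin 3) (Fin 3) K).mulVec (Pi.single i 1) + c • (g : Matrix (Fin 3) (Fin 3) K).mulVec (Pi.single j 1) with hx
    have hcol : ((g * E : GL (Fin 3) K) : Matrix (Fin 3) (Fin 3) K).mulVec (Pi.single i 1) = x := by
      rw [Units.val_mul, ← Matrix.mulVec_mulVec, hEval, transvection_mulVec_single, if_pos rfl, Matrix.mulVec_add, Matrix.mulVec_smul]
    have hherm : formCongr σ g ((StdForm.antidiagonal 3).over K) j i = σ β := by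
      rw [hβ, hG, hG]; exact (isHermitianForm_B₀ hd.σσ _ _).symm
    have hBxx : B₀ σ 3 x x = 1 + (formCongr σ g ((StdForm.antidiagonal 3).over K) i i + σ c * c * formCongr σ g ((StdForm.antidiagonal 3).over K) j j) := by
      have hcβ : c * β = t := div_mul_cancel₀ t hβ0
      have h1 : B₀ σ 3 x x = formCongr σ g ((StdForm.antidiagonal 3).over K) i i + c * β + σ c * σ β +
          σ c * (c * formCongr σ g ((StdForm.antidiagonal 3).over K) j j) := by
        simp only [hx, map_add, LinearMap.add_apply, form_smul_left, form_smul_right, ← hG, hherm, ← hβ]; ring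
      rw [h1, ← map_mul, hcβ, ← htt]; ring
    have hvBxx : Valued.v (B₀ σ 3 x x) = 1 := by
      rw [hBxx]
      refine Valuation.map_one_add_of_lt _ (Valuation.map_add_lt _ (lt_of_le_of_ne (hint i i) (hdiag i)) ?_)
      rw [map_mul, map_mul, hd.vσ]
      calc Valued.v c * Valued.v c * Valued.v (formCongr σ g ((StdForm.antidiagonal 3).over K) j j)
          ≤ 1 * 1 * Valued.v (formCongr σ g ((StdForm.antidiagonal 3).over K) j j) := mul_le_mul' (mul_le_mul' hvc hvc) le_rfl
        _ < 1 := by rw [one_mul, one_mul]; exact lt_of_le_of_ne (hint j j) (hdiag j)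
    obtain ⟨P, hP, hP', hPi⟩ := hswap i
    refine ⟨g * E * P, ?_, ?_⟩
    · rw [latt_mul_eq_of_isIntMatrix _ P hP hP', latt_mul_eq_of_isIntMatrix g E hEint hEint']
    · rw [Units.val_mul, ← Matrix.mulVec_mulVec, hPi, hcol]; exact hvBxx

/-! ## §31 An orthogonal basis adapted to the unit vector -/

/-- **JORDAN SPLITTING, matrix form**: a type-two vertex lattice `M` of `(K³, J₀)` (unramified datum) has a basis `g` with `|h(g e₀, g e₀)| = 1` and `h(g e₀, g e₁) = h(g e₀, g e₂) = 0`
(two transvections `e_j ↦ e_j − (h(x, g e_j) ∕ h(x,x))·e₀` applied to the basis of `exists_basis_v_B₀_eq_one`): `M = 𝒪x ⊥ N′`. [cite: Jacobowitz1962, §4] [cite: Omeara1963, §91C] -/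
theorem exists_orthogonal_basis (hd : UnramifiedLocalConjDatum σ ϖ) {M : Submodule 𝒪[K] (Fin 3 → K)} (hM : IsVertexLattice σ ϖ ((StdForm.antidiagonal 3).over K) 2 M) :
    ∃ g : GL (Fin 3) K, M = latt (g : Matrix (Fin 3) (Fin 3) K) ∧
      Valued.v (B₀ σ 3 ((g : Matrix (Fin 3) (Fin 3) K).mulVec (Pi.single 0 1)) ((g : Matrix (Fin 3) (Fin 3) K).mulVec (Pi.single 0 1))) = 1 ∧
      B₀ σ 3 ((g : Matrix (Fin 3) (Fin 3) K).mulVec (Pi.single 0 1)) ((g : Matrix (Fin 3) (Fin 3) K).mulVec (Pi.single 1 1)) = 0 ∧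
      B₀ σ 3 ((g : Matrix (Fin 3) (Fin 3) K).mulVec (Pi.single 0 1)) ((g : Matrix (Fin 3) (Fin 3) K).mulVec (Pi.single 2 1)) = 0 := by
  obtain ⟨g, rfl, hx⟩ := exists_basis_v_B₀_eq_one hd hM
  obtain ⟨hint, -, -⟩ := vertexTriple_of_latt_eq hd.vσ hM
  have hG : ∀ a b, formCongr σ g ((StdForm.antidiagonal 3).over K) a b =
      B₀ σ 3 ((g : Matrix (Fin 3) (Fin 3) K).mulVec (Pi.single a 1)) ((g : Matrix (Fin 3) (Fin 3) K).mulVec (Pi.single b 1)) := formCongr_apply_eq_B₀ g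
  set x : Fin 3 → K := (g : Matrix (Fin 3) (Fin 3) K).mulVec (Pi.single 0 1) with hxdef
  set ε : K := B₀ σ 3 x x with hε
  have hε0 : ε ≠ 0 := fun h => by rw [h, map_zero] at hx; exact zero_ne_one hx
  -- the two transvection coefficients
  have hcoef : ∀ k : Fin 3, Valued.v (-(B₀ σ 3 x ((g : Matrix (Fin 3) (Fin 3) K).mulVec (Pi.single k 1))) / ε) ≤ 1 := fun k => by
    rw [map_div₀, Valuation.map_neg, hx, div_one, hxdef, ← hG]; exact hint 0 k
  have hT : ∀ k : Fin 3, k ≠ 0 → ∀ a : K, Valued.v a ≤ 1 → ∃ T : GL (Fin 3) K, IsIntMatrix (T : Matrix (Fin 3) (Fin 3) K) ∧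
      IsIntMatrix ((T⁻¹ : GL (Fin 3) K) : Matrix (Fin 3) (Fin 3) K) ∧ (T : Matrix (Fin 3) (Fin 3) K) = Matrix.transvection 0 k a := by
    intro k hk a ha
    have hdetT : (Matrix.transvection 0 k a : Matrix (Fin 3) (Fin 3) K).det ≠ 0 := by rw [Matrix.det_transvection_of_ne 0 k hk.symm a]; exact one_ne_zero
    refine ⟨Matrix.GeneralLinearGroup.mkOfDetNeZero _ hdetT, isIntMatrix_transvection ha, ?_, rfl⟩
    rw [Matrix.coe_units_inv, show ((Matrix.GeneralLinearGroup.mkOfDetNeZero _ hdetT : GL (Fin 3) K) : Matrix (Fin 3) (Fin 3) K) = Matrix.transvection 0 k a from rfl,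
      Matrix.inv_eq_left_inv (by rw [Matrix.transvection_mul_transvection_same 0 k hk.symm, neg_add_cancel, Matrix.transvection_zero])]
    exact isIntMatrix_transvection (by rw [Valuation.map_neg]; exact ha)
  obtain ⟨T₁, hT₁, hT₁', hT₁v⟩ := hT 1 (by decide) _ (hcoef 1)
  obtain ⟨T₂, hT₂, hT₂', hT₂v⟩ := hT 2 (by decide) _ (hcoef 2)
  refine ⟨g * T₁ * T₂, by rw [latt_mul_eq_of_isIntMatrix _ T₂ hT₂ hT₂', latt_mul_eq_of_isIntMatrix g T₁ hT₁ hT₁'], ?_, ?_, ?_⟩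
  all_goals simp only [Units.val_mul, ← Matrix.mulVec_mulVec, hT₁v, hT₂v, transvection_mulVec_single, Fin.reduceEq, if_false, if_true, zero_smul, add_zero,
    Matrix.mulVec_add, Matrix.mulVec_smul, map_add, form_smul_right]
  · exact hx
  · rw [← hxdef, ← hε, div_mul_cancel₀ _ hε0, add_neg_cancel]
  · rw [← hxdef, ← hε, div_mul_cancel₀ _ hε0, add_neg_cancel]

/-! ## §32 The `2 × 2` block of the Gram matrix in an orthogonal basis -/

/-- **THE TYPE-TWO BLOCK.**  In a basis `g` of a type-two vertex lattice of `(K³, J₀)` with `|h(g₀,g₀)| = 1` and `h(g₀,g₁) = h(g₀,g₂) = 0` (so `G = [ε] ⊕ G₁`): the block `G₁` has all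
its entries in `ϖ𝒪` (they are `ε⁻¹ ×` entries of `adj G = det G · G⁻¹ ∈ ϖ·M₃(𝒪)`) and `|det G₁| = |h(g₁,g₁)h(g₂,g₂) − h(g₁,g₂)h(g₂,g₁)| = |ϖ|²` — `N′ = 𝒪g₁ + 𝒪g₂` is a `ϖ`-MODULAR
plane. [cite: Jacobowitz1962, §4] [cite: Omeara1963, §91C] -/
theorem typeTwo_block (hd : UnramifiedLocalConjDatum σ ϖ) {g : GL (Fin 3) K} (hM : IsVertexLattice σ ϖ ((StdForm.antidiagonal 3).over K) 2 (latt (g : Matrix (Fin 3) (Fin 3) K)))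
    (hx : Valued.v (B₀ σ 3 ((g : Matrix (Fin 3) (Fin 3) K).mulVec (Pi.single 0 1)) ((g : Matrix (Fin 3) (Fin 3) K).mulVec (Pi.single 0 1))) = 1)
    (h01 : B₀ σ 3 ((g : Matrix (Fin 3) (Fin 3) K).mulVec (Pi.single 0 1)) ((g : Matrix (Fin 3) (Fin 3) K).mulVec (Pi.single 1 1)) = 0)
    (h02 : B₀ σ 3 ((g : Matrix (Fin 3) (Fin 3) K).mulVec (Pi.single 0 1)) ((g : Matrix (Fin 3) (Fin 3) K).mulVec (Pi.single 2 1)) = 0) :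
    (∀ a b : Fin 3, a ≠ 0 → b ≠ 0 →
      Valued.v (B₀ σ 3 ((g : Matrix (Fin 3) (Fin 3) K).mulVec (Pi.single a 1)) ((g : Matrix (Fin 3) (Fin 3) K).mulVec (Pi.single b 1))) ≤ Valued.v ϖ) ∧
    Valued.v (B₀ σ 3 ((g : Matrix (Fin 3) (Fin 3) K).mulVec (Pi.single 1 1)) ((g : Matrix (Fin 3) (Fin 3) K).mulVec (Pi.single 1 1)) *
        B₀ σ 3 ((g : Matrix (Fin 3) (Fin 3) K).mulVec (Pi.single 2 1)) ((g : Matrix (Fin 3) (Fin 3) K).mulVec (Pi.single 2 1)) -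
      B₀ σ 3 ((g : Matrix (Fin 3) (Fin 3) K).mulVec (Pi.single 1 1)) ((g : Matrix (Fin 3) (Fin 3) K).mulVec (Pi.single 2 1)) *
        B₀ σ 3 ((g : Matrix (Fin 3) (Fin 3) K).mulVec (Pi.single 2 1)) ((g : Matrix (Fin 3) (Fin 3) K).mulVec (Pi.single 1 1))) = Valued.v ϖ ^ 2 := by
  have hϖ0 : ϖ ≠ 0 := uniformizer_ne_zero hd.vϖ
  obtain ⟨hint, hinv, hdet⟩ := vertexTriple_of_latt_eq hd.vσ hM
  set G := formCongr σ g ((StdForm.antidiagonal 3).over K) with hGdef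
  have hG : ∀ a b, G a b = B₀ σ 3 ((g : Matrix (Fin 3) (Fin 3) K).mulVec (Pi.single a 1)) ((g : Matrix (Fin 3) (Fin 3) K).mulVec (Pi.single b 1)) := formCongr_apply_eq_B₀ g
  have hherm : ∀ a b, G b a = σ (G a b) := fun a b => by rw [hG, hG]; exact (isHermitianForm_B₀ hd.σσ _ _).symm
  have hG01 : G 0 1 = 0 := by rw [hG]; exact h01
  have hG02 : G 0 2 = 0 := by rw [hG]; exact h02
  have hG10 : G 1 0 = 0 := by rw [hherm, hG01, map_zero]
  have hG20 : G 2 0 = 0 := by rw [hherm, hG02, map_zero]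
  have hε : Valued.v (G 0 0) = 1 := by rw [hG]; exact hx
  -- `det G = ε · det G₁`
  have hdetG : G.det = G 0 0 * (G 1 1 * G 2 2 - G 1 2 * G 2 1) := by rw [Matrix.det_fin_three, hG01, hG02, hG10, hG20]; ring
  have hblock : Valued.v (G 1 1 * G 2 2 - G 1 2 * G 2 1) = Valued.v ϖ ^ 2 := by
    have h := hdet; rwa [hdetG, map_mul, hε, one_mul] at h
  refine ⟨?_, by rw [← hG, ← hG, ← hG, ← hG]; exact hblock⟩
  -- `adj G = det G · G⁻¹ ∈ ϖ M₃(𝒪)`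
  have hGu : IsUnit G.det := by
    rw [isUnit_iff_ne_zero]; intro h; rw [h, map_zero] at hdet; exact pow_ne_zero 2 ((Valuation.ne_zero_iff _).2 hϖ0) hdet.symm
  have hadj : ∀ a b, Valued.v (G.adjugate a b) ≤ Valued.v ϖ := by
    intro a b
    have hadjeq : G.adjugate = (G.det * ϖ⁻¹) • (ϖ • G⁻¹) := by
      rw [smul_smul, mul_assoc, inv_mul_cancel₀ hϖ0, mul_one, Matrix.inv_def, smul_smul, Ring.inverse_eq_inv', mul_inv_cancel₀ hGu.ne_zero, one_smul]
    have hvϖ0 : Valued.v ϖ ≠ 0 := (Valuation.ne_zero_iff Valued.v).2 hϖ0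
    rw [hadjeq, Matrix.smul_apply, smul_eq_mul, map_mul, map_mul, map_inv₀, hdet, pow_two, mul_assoc, mul_assoc, mul_inv_cancel_left₀ hvϖ0]
    exact mul_le_of_le_one_right' (hinv a b)
  -- the four entries of the block are `ε⁻¹ × (± adj G)`
  have e11 : G.adjugate 2 2 = G 0 0 * G 1 1 - G 0 1 * G 1 0 := by rw [Matrix.adjugate_fin_three]; rfl
  have e22 : G.adjugate 1 1 = G 0 0 * G 2 2 - G 0 2 * G 2 0 := by rw [Matrix.adjugate_fin_three]; rfl
  have e12 : G.adjugate 1 2 = -(G 0 0 * G 1 2) + G 0 2 * G 1 0 := by rw [Matrix.adjugate_fin_three]; rfl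
  have e21 : G.adjugate 2 1 = -(G 0 0 * G 2 1) + G 0 1 * G 2 0 := by rw [Matrix.adjugate_fin_three]; rfl
  have h11 : Valued.v (G 1 1) ≤ Valued.v ϖ := by
    have h := hadj 2 2; rwa [e11, hG01, zero_mul, sub_zero, map_mul, hε, one_mul] at h
  have h22 : Valued.v (G 2 2) ≤ Valued.v ϖ := by
    have h := hadj 1 1; rwa [e22, hG02, zero_mul, sub_zero, map_mul, hε, one_mul] at h
  have h12 : Valued.v (G 1 2) ≤ Valued.v ϖ := by
    have h := hadj 1 2; rwa [e12, hG02, zero_mul, add_zero, Valuation.map_neg, map_mul, hε, one_mul] at h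
  have h21 : Valued.v (G 2 1) ≤ Valued.v ϖ := by
    have h := hadj 2 1; rwa [e21, hG01, zero_mul, add_zero, Valuation.map_neg, map_mul, hε, one_mul] at h
  intro a b ha hb
  rw [← hG]
  fin_cases a
  · exact absurd rfl ha
  · fin_cases b
    · exact absurd rfl hb
    · exact h11
    · exact h12
  · fin_cases b
    · exact absurd rfl hb
    · exact h21
    · exact h22

end Literature.NumberTheory.Automorphic.UnitaryLatticeTree

end
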